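import Summits.KontsevichZagierPeriods.KontsevichZagierPeriods.Theorems.HurwitzMicroSectorsNormalFormPrincipleM4SimplexFacts
import Literature.NumberTheory.Transcendental.EllIterRepShuffle

/-!
# `NormalFormPrinciple` (stmt-KontsevichZagierPeriods-3869), line `SketchIdeator1` —
# leaf `stub_boxRigidity`, layer `M4` toolkit: the shuffle `1 ⊗ 3` as a dissection

Pure proof file (registered sub-goal `m4_prism_shuffle13` of stmt-KontsevichZagierPeriods-3869,
line `SketchIdeator1`, lead seat c9; layer `M4` toolkit = the generic moves of the dimension-four
campaign of the leaf `stub_boxRigidity`; `--supports` the crux). SHUFFLE PRODUCTS as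
dissections, dimension four: the prism `P₁₃ = (0,1) × Δ₃ = {0 < t₀ < 1, 0 < t₃ < t₂ < t₁ < 1}`
carrying a product integrand `f(t₀) · (g(t₁) h(t₂) k(t₃))` (value `(∫ f) · (∫∫∫ g h k)`) is cut
by the three Lebesgue-null planes `{t₀ = t₁}`, `{t₀ = t₂}`, `{t₀ = t₃}` into four open simplices
according to the position of `t₀` among `t₁ > t₂ > t₃`:

* `C₁ = {t₃ < t₂ < t₁ < t₀}` — the decreasing simplex `Δ₄ = {0 < t₃ < t₂ < t₁ < t₀ < 1}` itself,
  word `f g h k`;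
* `C₂ = {t₃ < t₂ < t₀ < t₁}` — along the coordinate swap `0 ↔ 1` this is `Δ₄` with the word
  `g f h k`;
* `C₃ = {t₃ < t₀ < t₂ < t₁}` — along the `3`-cycle `0 ↦ 1 ↦ 2 ↦ 0` this is `Δ₄` with the word
  `g h f k`;
* `C₄ = {t₀ < t₃ < t₂ < t₁}` — along the `4`-cycle `finRotate 4` this is `Δ₄` with the word
  `g h k f`.

Hence `[P₁₃, f ⊗ g h k] − [Δ₄, fghk] − [Δ₄, gfhk] − [Δ₄, ghfk] − [Δ₄, ghkf] ∈ KZ.relations` (the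
shuffle `f ш (g h k)`), for GIVEN representations `TP`, `W1`, …, `W4` with these domains and
integrands (EqOn form; `f`, `g`, `h`, `k` arbitrary real functions). Chain of moves: iterated
domain additivity over the finite partition `P₁₃ = C₁ ⊔ C₂ ⊔ C₃ ⊔ C₄ (mod null)` (rule (1a),
`KZ.of_sub_sum_of_mem_relations_of_subset`; the remainder lies on the three diagonal planes,
null by `KZ.volume_setOf_apply_eq_apply`), the pieces over `C₂`, `C₃`, `C₄` being the reindexed
carriers `W2`, `W3`, `W4`, and three coordinate-permutation moves (rule (2),
`KZ.of_sub_of_reindex_mem_relations`) identifying `[Wᵢ]` with its reindexed copy.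

References: M. Kontsevich, D. Zagier, *Periods* (2001), §1.1–1.2, rules (1), (2). No definitions
are introduced.
-/

noncomputable section

open MeasureTheory Set
open Literature.NumberTheory.Transcendental Literature.NumberTheory.Transcendental.KZ
open Literature.ModelTheory.ExponentialFields (IsSemialgebraic)

namespace Summit.KontsevichZagierPeriods.HurwitzMicroSectors.NormalFormPrinciple.PiBox.M3

/-! ## The three permuted simplices `C₂`, `C₃`, `C₄` -/

/-- The domain of a representation over `Δ₄ = {0 < t₃ < t₂ < t₁ < t₀ < 1}` reindexed along
`Equiv.swap 0 1` is `C₂ = {0 < t₃ < t₂ < t₀ < t₁ < 1}`. [folklore] -/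
theorem m4h_reindex_swap_domain (W : IntegralRep 4)
    (hWd : W.domain = {t | 0 < t 3 ∧ t 3 < t 2 ∧ t 2 < t 1 ∧ t 1 < t 0 ∧ t 0 < 1}) :
    (W.reindex (Equiv.swap (0 : Fin 4) 1)).domain =
      {t | 0 < t 3 ∧ t 3 < t 2 ∧ t 2 < t 0 ∧ t 0 < t 1 ∧ t 1 < 1} := by
  have hs : Equiv.swap (0 : Fin 4) 1 2 = 2 ∧ Equiv.swap (0 : Fin 4) 1 3 = 3 := by decide
  ext w
  simp only [IntegralRep.reindex_domain, hWd, mem_setOf_eq, Equiv.swap_apply_left,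
    Equiv.swap_apply_right, hs.1, hs.2]

/-- The integrand of a representation of the word `g f h k` over `Δ₄` reindexed along
`Equiv.swap 0 1` agrees with the product `f(t₀) · (g(t₁) h(t₂) k(t₃))` on its domain.
[folklore] -/
theorem m4h_reindex_swap_integrand (f g h k : ℝ → ℝ) (W : IntegralRep 4)
    (hWi : EqOn W.integrand (fun t => g (t 0) * f (t 1) * h (t 2) * k (t 3)) W.domain) :
    EqOn (W.reindex (Equiv.swap (0 : Fin 4) 1)).integrand
      (fun t => f (t 0) * (g (t 1) * h (t 2) * k (t 3)))
      (W.reindex (Equiv.swap (0 : Fin 4) 1)).domain := by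
  intro w hw
  have hw' : (fun i => w (Equiv.swap (0 : Fin 4) 1 i)) ∈ W.domain := by
    rw [IntegralRep.reindex_domain] at hw
    exact hw
  rw [IntegralRep.reindex_integrand]
  show W.integrand (fun i => w (Equiv.swap (0 : Fin 4) 1 i)) =
    f (w 0) * (g (w 1) * h (w 2) * k (w 3))
  have hs : Equiv.swap (0 : Fin 4) 1 2 = 2 ∧ Equiv.swap (0 : Fin 4) 1 3 = 3 := by decide
  rw [hWi hw']
  simp only [Equiv.swap_apply_left, Equiv.swap_apply_right, hs.1, hs.2]
  ring

/-- The domain of a representation over `Δ₄ = {0 < t₃ < t₂ < t₁ < t₀ < 1}` reindexed along the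
`3`-cycle `0 ↦ 1`, `1 ↦ 2`, `2 ↦ 0` (`3` fixed) is `C₃ = {0 < t₃ < t₀ < t₂ < t₁ < 1}`.
[folklore] -/
theorem m4h_reindex_cyc_domain (W : IntegralRep 4)
    (hWd : W.domain = {t | 0 < t 3 ∧ t 3 < t 2 ∧ t 2 < t 1 ∧ t 1 < t 0 ∧ t 0 < 1}) :
    (W.reindex ((Equiv.swap (1 : Fin 4) 2).trans (Equiv.swap 0 1))).domain =
      {t | 0 < t 3 ∧ t 3 < t 0 ∧ t 0 < t 2 ∧ t 2 < t 1 ∧ t 1 < 1} := by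
  have he : ((Equiv.swap (1 : Fin 4) 2).trans (Equiv.swap 0 1)) 0 = 1 ∧
      ((Equiv.swap (1 : Fin 4) 2).trans (Equiv.swap 0 1)) 1 = 2 ∧
      ((Equiv.swap (1 : Fin 4) 2).trans (Equiv.swap 0 1)) 2 = 0 ∧
      ((Equiv.swap (1 : Fin 4) 2).trans (Equiv.swap 0 1)) 3 = 3 := by decide
  ext w
  simp only [IntegralRep.reindex_domain, hWd, mem_setOf_eq, he.1, he.2.1, he.2.2.1, he.2.2.2]

/-- The integrand of a representation of the word `g h f k` over `Δ₄` reindexed along the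
`3`-cycle `0 ↦ 1`, `1 ↦ 2`, `2 ↦ 0` agrees with the product `f(t₀) · (g(t₁) h(t₂) k(t₃))` on its
domain. [folklore] -/
theorem m4h_reindex_cyc_integrand (f g h k : ℝ → ℝ) (W : IntegralRep 4)
    (hWi : EqOn W.integrand (fun t => g (t 0) * h (t 1) * f (t 2) * k (t 3)) W.domain) :
    EqOn (W.reindex ((Equiv.swap (1 : Fin 4) 2).trans (Equiv.swap 0 1))).integrand
      (fun t => f (t 0) * (g (t 1) * h (t 2) * k (t 3)))
      (W.reindex ((Equiv.swap (1 : Fin 4) 2).trans (Equiv.swap 0 1))).domain := by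
  intro w hw
  have hw' : (fun i => w (((Equiv.swap (1 : Fin 4) 2).trans (Equiv.swap 0 1)) i)) ∈
      W.domain := by
    rw [IntegralRep.reindex_domain] at hw
    exact hw
  rw [IntegralRep.reindex_integrand]
  show W.integrand (fun i => w (((Equiv.swap (1 : Fin 4) 2).trans (Equiv.swap 0 1)) i)) =
    f (w 0) * (g (w 1) * h (w 2) * k (w 3))
  have he : ((Equiv.swap (1 : Fin 4) 2).trans (Equiv.swap 0 1)) 0 = 1 ∧
      ((Equiv.swap (1 : Fin 4) 2).trans (Equiv.swap 0 1)) 1 = 2 ∧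
      ((Equiv.swap (1 : Fin 4) 2).trans (Equiv.swap 0 1)) 2 = 0 ∧
      ((Equiv.swap (1 : Fin 4) 2).trans (Equiv.swap 0 1)) 3 = 3 := by decide
  rw [hWi hw']
  simp only [he.1, he.2.1, he.2.2.1, he.2.2.2]
  ring

/-- The domain of a representation over `Δ₄ = {0 < t₃ < t₂ < t₁ < t₀ < 1}` reindexed along the
`4`-cycle `finRotate 4` (`0 ↦ 1`, `1 ↦ 2`, `2 ↦ 3`, `3 ↦ 0`) is `C₄ = {0 < t₀ < t₃ < t₂ < t₁ < 1}`.
[folklore] -/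
theorem m4h_reindex_rot_domain (W : IntegralRep 4)
    (hWd : W.domain = {t | 0 < t 3 ∧ t 3 < t 2 ∧ t 2 < t 1 ∧ t 1 < t 0 ∧ t 0 < 1}) :
    (W.reindex (finRotate 4)).domain =
      {t | 0 < t 0 ∧ t 0 < t 3 ∧ t 3 < t 2 ∧ t 2 < t 1 ∧ t 1 < 1} := by
  have he : finRotate 4 0 = 1 ∧ finRotate 4 1 = 2 ∧ finRotate 4 2 = 3 ∧ finRotate 4 3 = 0 := by
    decide
  ext w
  simp only [IntegralRep.reindex_domain, hWd, mem_setOf_eq, he.1, he.2.1, he.2.2.1, he.2.2.2]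

/-- The integrand of a representation of the word `g h k f` over `Δ₄` reindexed along
`finRotate 4` agrees with the product `f(t₀) · (g(t₁) h(t₂) k(t₃))` on its domain. [folklore] -/
theorem m4h_reindex_rot_integrand (f g h k : ℝ → ℝ) (W : IntegralRep 4)
    (hWi : EqOn W.integrand (fun t => g (t 0) * h (t 1) * k (t 2) * f (t 3)) W.domain) :
    EqOn (W.reindex (finRotate 4)).integrand
      (fun t => f (t 0) * (g (t 1) * h (t 2) * k (t 3)))
      (W.reindex (finRotate 4)).domain := by
  intro w hw
  have hw' : (fun i => w (finRotate 4 i)) ∈ W.domain := by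
    rw [IntegralRep.reindex_domain] at hw
    exact hw
  rw [IntegralRep.reindex_integrand]
  show W.integrand (fun i => w (finRotate 4 i)) = f (w 0) * (g (w 1) * h (w 2) * k (w 3))
  have he : finRotate 4 0 = 1 ∧ finRotate 4 1 = 2 ∧ finRotate 4 2 = 3 ∧ finRotate 4 3 = 0 := by
    decide
  rw [hWi hw']
  simp only [he.1, he.2.1, he.2.2.1, he.2.2.2]
  ring

/-! ## The registered sub-goal -/

/-- **Stub `m4_prism_shuffle13` (registered sub-goal of stmt-KontsevichZagierPeriods-3869, line
`SketchIdeator1`, layer `M4` toolkit).** The shuffle product `f ш (g h k)` as a dissection: for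
representations `TP = [P₁₃, ·]` over the prism `P₁₃ = {0 < t₀ < 1, 0 < t₃ < t₂ < t₁ < 1}` and
`W1, …, W4 = [Δ₄, ·]` over the decreasing simplex `Δ₄ = {0 < t₃ < t₂ < t₁ < t₀ < 1}` whose
integrands agree on their domains with `f(t₀) (g(t₁) h(t₂) k(t₃))`, `f g h k`, `g f h k`,
`g h f k`, `g h k f` (letters applied to `t₀, t₁, t₂, t₃` in this order) respectively,
`[TP] − [W1] − [W2] − [W3] − [W4] ∈ KZ.relations`: the four cells `C₁ = Δ₄`,
`C₂ = {t₃ < t₂ < t₀ < t₁}`, `C₃ = {t₃ < t₀ < t₂ < t₁}`, `C₄ = {t₀ < t₃ < t₂ < t₁}` (position of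
`t₀` among `t₁ > t₂ > t₃`) are pairwise disjoint and cover `P₁₃` off the null planes `{t₀ = t₁}`,
`{t₀ = t₂}`, `{t₀ = t₃}`, so iterated domain additivity (rule (1a),
`KZ.of_sub_sum_of_mem_relations_of_subset`) gives `[TP] − [W1] − [V2] − [V3] − [V4]` for the
reindexed carriers `V2 = W2 ∘ (0 1)`, `V3 = W3 ∘ (0 1 2)`, `V4 = W4 ∘ finRotate 4` living over
`C₂`, `C₃`, `C₄`; and `[Wᵢ] − [Vᵢ]` are coordinate-permutation moves (rule (2),
`KZ.of_sub_of_reindex_mem_relations`). [cite: KontsevichZagier2001, §1.2 rules (1), (2)] -/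
theorem m4_prism_shuffle13 :
    ∀ (f g h k : ℝ → ℝ) (TP W1 W2 W3 W4 : IntegralRep 4),
      TP.domain = {t | 0 < t 0 ∧ t 0 < 1 ∧ 0 < t 3 ∧ t 3 < t 2 ∧ t 2 < t 1 ∧ t 1 < 1} →
      EqOn TP.integrand (fun t => f (t 0) * (g (t 1) * h (t 2) * k (t 3))) TP.domain →
      W1.domain = {t | 0 < t 3 ∧ t 3 < t 2 ∧ t 2 < t 1 ∧ t 1 < t 0 ∧ t 0 < 1} →
      EqOn W1.integrand (fun t => f (t 0) * g (t 1) * h (t 2) * k (t 3)) W1.domain →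
      W2.domain = {t | 0 < t 3 ∧ t 3 < t 2 ∧ t 2 < t 1 ∧ t 1 < t 0 ∧ t 0 < 1} →
      EqOn W2.integrand (fun t => g (t 0) * f (t 1) * h (t 2) * k (t 3)) W2.domain →
      W3.domain = {t | 0 < t 3 ∧ t 3 < t 2 ∧ t 2 < t 1 ∧ t 1 < t 0 ∧ t 0 < 1} →
      EqOn W3.integrand (fun t => g (t 0) * h (t 1) * f (t 2) * k (t 3)) W3.domain →
      W4.domain = {t | 0 < t 3 ∧ t 3 < t 2 ∧ t 2 < t 1 ∧ t 1 < t 0 ∧ t 0 < 1} →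
      EqOn W4.integrand (fun t => g (t 0) * h (t 1) * k (t 2) * f (t 3)) W4.domain →
      of TP - of W1 - of W2 - of W3 - of W4 ∈ relations := by
  intro f g h k TP W1 W2 W3 W4 hTPd hTPi hW1d hW1i hW2d hW2i hW3d hW3i hW4d hW4i
  -- the permutation moves (rule 2): `[Wᵢ] − [Wᵢ ∘ eᵢ]`, `i = 2, 3, 4`
  have h2d := m4h_reindex_swap_domain W2 hW2d
  have h2i := m4h_reindex_swap_integrand f g h k W2 hW2i
  have e2 : of W2 - of (W2.reindex (Equiv.swap (0 : Fin 4) 1)) ∈ relations :=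
    of_sub_of_reindex_mem_relations W2 (Equiv.swap (0 : Fin 4) 1)
  generalize W2.reindex (Equiv.swap (0 : Fin 4) 1) = V2 at h2d h2i e2
  have h3d := m4h_reindex_cyc_domain W3 hW3d
  have h3i := m4h_reindex_cyc_integrand f g h k W3 hW3i
  have e3 : of W3 - of (W3.reindex ((Equiv.swap (1 : Fin 4) 2).trans (Equiv.swap 0 1))) ∈
      relations :=
    of_sub_of_reindex_mem_relations W3 ((Equiv.swap (1 : Fin 4) 2).trans (Equiv.swap 0 1))
  generalize W3.reindex ((Equiv.swap (1 : Fin 4) 2).trans (Equiv.swap 0 1)) = V3 at h3d h3i e3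
  have h4d := m4h_reindex_rot_domain W4 hW4d
  have h4i := m4h_reindex_rot_integrand f g h k W4 hW4i
  have e4 : of W4 - of (W4.reindex (finRotate 4)) ∈ relations :=
    of_sub_of_reindex_mem_relations W4 (finRotate 4)
  generalize W4.reindex (finRotate 4) = V4 at h4d h4i e4
  -- the four cells `C₁ = W1.domain`, `C₂ = V2.domain`, `C₃ = V3.domain`, `C₄ = V4.domain` sit
  -- inside the prism
  have hsub1 : W1.domain ⊆ TP.domain := by
    rw [hW1d, hTPd]
    rintro t ⟨h3, h32, h21, h10, h0⟩
    exact ⟨by linarith, h0, h3, h32, h21, by linarith⟩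
  have hsub2 : V2.domain ⊆ TP.domain := by
    rw [h2d, hTPd]
    rintro t ⟨h3, h32, h20, h01, h1⟩
    exact ⟨by linarith, by linarith, h3, h32, by linarith, h1⟩
  have hsub3 : V3.domain ⊆ TP.domain := by
    rw [h3d, hTPd]
    rintro t ⟨h3, h30, h02, h21, h1⟩
    exact ⟨by linarith, by linarith, h3, by linarith, h21, h1⟩
  have hsub4 : V4.domain ⊆ TP.domain := by
    rw [h4d, hTPd]
    rintro t ⟨h0, h03, h32, h21, h1⟩
    exact ⟨h0, by linarith, by linarith, h32, h21, h1⟩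
  -- and are pairwise disjoint (incompatible orders of the coordinates)
  have d12 : Disjoint W1.domain V2.domain := by
    rw [hW1d, h2d]
    exact Set.disjoint_left.2 fun t ht ht' => lt_asymm ht.2.2.2.1 ht'.2.2.2.1
  have d13 : Disjoint W1.domain V3.domain := by
    rw [hW1d, h3d]
    exact Set.disjoint_left.2 fun t ht ht' => lt_asymm (ht.2.2.1.trans ht.2.2.2.1) ht'.2.2.1
  have d14 : Disjoint W1.domain V4.domain := by
    rw [hW1d, h4d]
    exact Set.disjoint_left.2 fun t ht ht' =>
      lt_asymm ((ht.2.1.trans ht.2.2.1).trans ht.2.2.2.1) ht'.2.1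
  have d23 : Disjoint V2.domain V3.domain := by
    rw [h2d, h3d]
    exact Set.disjoint_left.2 fun t ht ht' => lt_asymm ht.2.2.1 ht'.2.2.1
  have d24 : Disjoint V2.domain V4.domain := by
    rw [h2d, h4d]
    exact Set.disjoint_left.2 fun t ht ht' => lt_asymm (ht.2.1.trans ht.2.2.1) ht'.2.1
  have d34 : Disjoint V3.domain V4.domain := by
    rw [h3d, h4d]
    exact Set.disjoint_left.2 fun t ht ht' => lt_asymm ht.2.1 ht'.2.1
  -- the pieces carry the integrand of `TP`
  have he1 : EqOn W1.integrand TP.integrand W1.domain := by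
    intro t ht
    rw [hTPi (hsub1 ht), hW1i ht]
    show f (t 0) * g (t 1) * h (t 2) * k (t 3) = f (t 0) * (g (t 1) * h (t 2) * k (t 3))
    ring
  have he2 : EqOn V2.integrand TP.integrand V2.domain :=
    fun t ht => (h2i ht).trans (hTPi (hsub2 ht)).symm
  have he3 : EqOn V3.integrand TP.integrand V3.domain :=
    fun t ht => (h3i ht).trans (hTPi (hsub3 ht)).symm
  have he4 : EqOn V4.integrand TP.integrand V4.domain :=
    fun t ht => (h4i ht).trans (hTPi (hsub4 ht)).symm
  -- the three cutting planes are null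
  have hp1 : volume {t : Fin 4 → ℝ | t 0 = t 1} = 0 := volume_setOf_apply_eq_apply (by decide)
  have hp2 : volume {t : Fin 4 → ℝ | t 0 = t 2} = 0 := volume_setOf_apply_eq_apply (by decide)
  have hp3 : volume {t : Fin 4 → ℝ | t 0 = t 3} = 0 := volume_setOf_apply_eq_apply (by decide)
  -- the complement of the four cells in the prism lies on the three planes
  have hrem : TP.domain \ (W1.domain ∪ V2.domain ∪ V3.domain ∪ V4.domain) ⊆
      {t : Fin 4 → ℝ | t 0 = t 1} ∪ {t | t 0 = t 2} ∪ {t | t 0 = t 3} := by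
    intro t ht
    rw [hTPd, hW1d, h2d, h3d, h4d] at ht
    obtain ⟨⟨h0, h01, h3, h32, h21, h1⟩, hn⟩ := ht
    rcases lt_trichotomy (t 0) (t 1) with hlt1 | heq1 | hgt1
    · rcases lt_trichotomy (t 0) (t 2) with hlt2 | heq2 | hgt2
      · rcases lt_trichotomy (t 0) (t 3) with hlt3 | heq3 | hgt3
        · exact absurd (Or.inr ⟨h0, hlt3, h32, h21, h1⟩) hn
        · exact Or.inr heq3
        · exact absurd (Or.inl (Or.inr ⟨h3, hgt3, hlt2, h21, h1⟩)) hn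
      · exact Or.inl (Or.inr heq2)
      · exact absurd (Or.inl (Or.inl (Or.inr ⟨h3, h32, hgt2, hlt1, h1⟩))) hn
    · exact Or.inl (Or.inl heq1)
    · exact absurd (Or.inl (Or.inl (Or.inl ⟨h3, h32, h21, hgt1, h01⟩))) hn
  have hnull : volume (TP.domain \ (W1.domain ∪ V2.domain ∪ V3.domain ∪ V4.domain)) = 0 :=
    measure_mono_null hrem (measure_union_null (measure_union_null hp1 hp2) hp3)
  -- iterated domain additivity over the partition `![W1, V2, V3, V4]` (rule 1a)
  have key := of_sub_sum_of_mem_relations_of_subset (Finset.univ : Finset (Fin 4)) TP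
    ![W1, V2, V3, V4]
    (by
      intro i _
      fin_cases i
      exacts [hsub1, hsub2, hsub3, hsub4])
    (by
      intro i _
      fin_cases i
      exacts [he1, he2, he3, he4])
    (by
      have hU : W1.domain ∪ V2.domain ∪ V3.domain ∪ V4.domain ⊆
          ⋃ i ∈ (Finset.univ : Finset (Fin 4)), (![W1, V2, V3, V4] i).domain := by
        intro z hz
        simp only [Finset.mem_univ, iUnion_true, mem_iUnion]
        rcases hz with ((hz | hz) | hz) | hz
        exacts [⟨0, hz⟩, ⟨1, hz⟩, ⟨2, hz⟩, ⟨3, hz⟩]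
      exact measure_mono_null (Set.sdiff_subset_sdiff_right hU) hnull)
    (by
      intro i _ j _ hij
      fin_cases i <;> fin_cases j
      all_goals
        first
        | exact absurd rfl hij
        | exact d12
        | exact d12.symm
        | exact d13
        | exact d13.symm
        | exact d14
        | exact d14.symm
        | exact d23
        | exact d23.symm
        | exact d24
        | exact d24.symm
        | exact d34
        | exact d34.symm)
  rw [Fin.sum_univ_four] at key
  change of TP - (of W1 + of V2 + of V3 + of V4) ∈ relations at key
  -- bookkeeping
  have e : of TP - of W1 - of W2 - of W3 - of W4 = of TP - (of W1 + of V2 + of V3 + of V4) -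
      (of W2 - of V2) - (of W3 - of V3) - (of W4 - of V4) := by
    abel
  rw [e]
  exact relations.sub_mem (relations.sub_mem (relations.sub_mem key e2) e3) e4

end Summit.KontsevichZagierPeriods.HurwitzMicroSectors.NormalFormPrinciple.PiBox.M3
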